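import Summits.BirchSwinnertonDyer.Rank1Residual.F1Sign2.TwoSelmerTransferLawAtTwo
import Literature.LinearAlgebra.Matrix.CharpolyShiftOddOrderRankOnePencil
import HarnessLib

/-!
# Cell `bsd-f1-sign2` — kernel bookkeeping for IMC-WP53 file 4 (`F1Sign2/TwoSelmerTransferLawAtTwo.lean`: the P53s family)

THEOREMS (+ one `Bool` truth-table `def`, REF1's T183h), no `sorry`, no named fact, no instance; ns `…Rank1Residual.F1Sign2` as the statement file.  Contents:
(1) -imc g17's proved bookkeeping from `HOME/MEMO-imc-data/dimc53/lean/Sketch53.lean` v9 564542c441264358 l.574–581 / l.653–657 VERBATIM: `dvd_two_mul_of_eq_or_double`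
(P53s♭ ⟹ P53s≤'s flat half, arithmetic shape) and `le_of_isLeast_of_mem`;
(2) REF1 §183's sorry-free certificates and glue from `HOME/REF1-data/b183/lean/Probe183v9.lean` d6410ed65f556a67 l.756–859 (ns `REF1g17b` → `F1Sign2`) VERBATIM:
T183b `evalReal_mem_realTwoTorsionRoots_of_carries` (a carrier maps real roots of `ψ_W` to real roots of `ψ_{W'}` — so `evalReal g x₁`, `evalReal g x₃` in
P53s/P53s♭/P53↻/P53½/P53∞ ARE 2-torsion abscissae of `W'`), T183c `orientation_exhaustive` / `orientation_exclusive`, T183d `clause_b_void_of_eq` (`Δ < 0`: clause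
(b) void), T183e `least_le_greatest` (diagonal carrier `g = X`), T183f `bound_diagonal`, **C183a `companionLaw_of_transferLaw` (P53s ⟹ P53s₀) and C183b
`flatBound_of_flatLaw` (P53s♭ ⟹ P53s≤ flat conjunct)** modulo `hex`, T183g `weilPairing_ne_distinct` / `anisotropic_sum_of_isotropic` (on `𝔽₂²` two distinct
non-zero isotropic vectors of ANY quadratic refinement of the Weil pairing have anisotropic sum — the kernel of the «double isotropy» step (ii)/(iii): the
archimedean image `I` has order `≤ 2`), T183h `prConicSplitsOverR` + `prForm_zero_set_eq_outer_roots` (the finite sign table behind D-imc-53-R5 (iv): the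
Poonen–Rains form at `∞` = class of the conic `(e₃−e₂)s₁X² − (e₃−e₁)s₂Y² + (e₂−e₁)s₃Z²`, split over `ℝ` iff `(s₁, ¬s₂, s₃)` are not all equal; zero set
`{0, T₁, T₃}` = the OUTER root classes, the middle class `T₂` is THE anisotropic vector); T183a `not_carriesTwoTorsion_C_of_irreducible` is NOT re-declared (same
name and statement already in `F1Sign2/HalfPeriodWeilPairingAtTwoKernel.lean`, -ty g16);
(3) typer discharge of REF1 rider R183f: `exists_mem_realTwoTorsionRoots` (odd degree over `ℝ`, via the tree's
`Literature.LinearAlgebra.Matrix.CharpolyShiftOddOrderRankOnePencil.exists_isRoot_of_odd_natDegree` — imported, not restated) and `exists_isLeast_isGreatest`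
(`min'`/`max'` of the finite non-empty root set), whence the UNCONDITIONAL glue `companionLaw_of_transferLaw'` : P53s → P53s₀ and `flatBound_of_flatLaw'` /
`transferBound_flat_of_flatLaw` : P53s♭ → (flat conjunct of P53s≤) — REF1 §183: «P53s₀ and P53s≤(flat) are COROLLARY rows, not separate obligations».
Typer -ty g17; std axioms {propext, Classical.choice, Quot.sound} checked on the farm.  BSD is not proved by this; no item closed; PARTITION none.
-/

set_option autoImplicit false

noncomputable section

open scoped Classical MatrixGroups ModularForm

open CongruenceSubgroup WeierstrassCurve Literature.NumberTheory.EllipticCurves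
  Literature.NumberTheory.EllipticCurves.ModularForms Literature.NumberTheory.EllipticCurves.Sprung2017

namespace Summit.BirchSwinnertonDyer.Rank1Residual.F1Sign2


/-! ## -imc g17 bookkeeping (Sketch53 v9 l.574–581 and l.653–657, verbatim) -/

/-- Bookkeeping: the exact flat law P53s♭ implies the flat half of the bound law P53s≤ pointwise (either the
orders are equal or one is twice the other). [folklore] -/
theorem dvd_two_mul_of_eq_or_double {a b : ℕ} (h : a = b ∨ (b = 2 * a ∨ a = 2 * b)) :
    a ∣ 2 * b ∧ b ∣ 2 * a := by
  rcases h with rfl | rfl | rfl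
  · exact ⟨Dvd.intro_left 2 rfl, Dvd.intro_left 2 rfl⟩
  · exact ⟨⟨4, by ring⟩, dvd_rfl⟩
  · exact ⟨dvd_rfl, ⟨4, by ring⟩⟩

/-- Bookkeeping: P53s(a) contains P53s₀ once one knows that a root bijection fixing the least root keeps the
orientation of the outer roots — here only the trivial order fact used in that reduction. [folklore] -/
theorem le_of_isLeast_of_mem {x y : ℝ} {W : WeierstrassCurve ℚ} (hx : IsLeastTwoTorsionRoot W x)
    (hy : y ∈ realTwoTorsionRoots W) : x ≤ y := hx.2 y hy


/-! ## REF1 §183 certificates and glue (`REF1-data/b183/lean/Probe183v9.lean` l.756–859, verbatim; T183a `not_carriesTwoTorsion_C_of_irreducible` is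
already in `F1Sign2/HalfPeriodWeilPairingAtTwoKernel.lean` and is not re-declared) -/

section Certificates183

/-- T183b: a carrier maps real roots of `ψ_W` to real roots of `ψ_{W'}` (so in P53s/P53s♭ the values
`evalReal g x₁`, `evalReal g x₃` ARE `2`-torsion abscissae of `W'`, and the orientation clause compares two
roots of `ψ_{W'}`). -/
theorem evalReal_mem_realTwoTorsionRoots_of_carries {W W' : WeierstrassCurve ℚ} {g : Polynomial ℚ}
    (hg : CarriesTwoTorsion W W' g) {x : ℝ} (hx : x ∈ realTwoTorsionRoots W) :
    evalReal g x ∈ realTwoTorsionRoots W' := by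
  obtain ⟨-, q, hq⟩ := hg
  unfold realTwoTorsionRoots at *
  have hne' : (W'.twoTorsionPolynomial.toPoly.map (algebraMap ℚ ℝ)) ≠ 0 := by
    rw [Ne, Polynomial.map_eq_zero_iff (algebraMap ℚ ℝ).injective]
    exact Cubic.ne_zero_of_a_ne_zero (by simp [WeierstrassCurve.twoTorsionPolynomial])
  have hne : (W.twoTorsionPolynomial.toPoly.map (algebraMap ℚ ℝ)) ≠ 0 := by
    rw [Ne, Polynomial.map_eq_zero_iff (algebraMap ℚ ℝ).injective]
    exact Cubic.ne_zero_of_a_ne_zero (by simp [WeierstrassCurve.twoTorsionPolynomial])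
  rw [Polynomial.mem_roots hne']
  have hxr := (Polynomial.mem_roots hne).mp hx
  have key := congrArg (fun p : Polynomial ℚ => (p.map (algebraMap ℚ ℝ)).eval x) hq
  simp only [Polynomial.map_comp, Polynomial.eval_comp, Polynomial.map_mul, Polynomial.eval_mul] at key
  rw [Polynomial.IsRoot.def] at hxr ⊢
  unfold evalReal
  rw [key, hxr, zero_mul]

/-- T183c: the orientation clauses (a)/(b) of P53s / P53s♭ are EXHAUSTIVE … -/
theorem orientation_exhaustive (g : Polynomial ℚ) (x₁ x₃ : ℝ) :
    evalReal g x₁ ≤ evalReal g x₃ ∨ evalReal g x₃ < evalReal g x₁ := le_or_gt _ _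

/-- … and EXCLUSIVE. -/
theorem orientation_exclusive (g : Polynomial ℚ) (x₁ x₃ : ℝ) :
    ¬ (evalReal g x₁ ≤ evalReal g x₃ ∧ evalReal g x₃ < evalReal g x₁) := fun h => absurd h.2 (not_lt.mpr h.1)

/-- T183d: in the `Δ < 0` reading (least root = greatest root) clause (b) is VOID, so P53s/P53s♭ assert
plain equality of `#Sel₂` there — as the docstrings say. -/
theorem clause_b_void_of_eq (g : Polynomial ℚ) (x : ℝ) : ¬ evalReal g x < evalReal g x := lt_irrefl _

/-- T183e: least and greatest real `2`-torsion roots are ordered (`x₁ ≤ x₃`), so for the identity carrier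
`g = X` (the pair `(W, W)`) clause (a) fires and clause (b) is void: P53s is consistent on the diagonal. -/
theorem least_le_greatest {W : WeierstrassCurve ℚ} {x₁ x₃ : ℝ} (h₁ : IsLeastTwoTorsionRoot W x₁)
    (h₃ : IsGreatestTwoTorsionRoot W x₃) : evalReal Polynomial.X x₁ ≤ evalReal Polynomial.X x₃ := by
  simp only [evalReal, Polynomial.map_X, Polynomial.eval_X]
  exact h₁.2 x₃ h₃.1

/-- T183f: the diagonal instance of the bound law is trivially consistent (`#Sel₂ ∣ 4·#Sel₂`, `∣ 2·#Sel₂`). -/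
theorem bound_diagonal (n : ℕ) : (n ∣ 4 * n ∧ n ∣ 4 * n) ∧ (n ∣ 2 * n ∧ n ∣ 2 * n) :=
  ⟨⟨dvd_mul_left n 4, dvd_mul_left n 4⟩, ⟨dvd_mul_left n 2, dvd_mul_left n 2⟩⟩

/-- C183a (GLUE, sorry-free): **P53s ⟹ P53s₀** — the companion law is the `g(e₁) = e'₁` case of clause (a)
of the transfer law, granted only that every `ψ_W` has a least and a greatest real root (true: a real cubic
has a real root; kept as a hypothesis to stay elementary). Uses T183b. -/
theorem companionLaw_of_transferLaw (h : TwoSelmerRankTransferLawAtTwo)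
    (hex : ∀ W : WeierstrassCurve ℚ, ∃ x₁ x₃ : ℝ, IsLeastTwoTorsionRoot W x₁ ∧ IsGreatestTwoTorsionRoot W x₃) :
    TwoSelmerCompanionLawAtTwo := by
  intro N _ W W' f f' hN hW hW' hf hf' hirr hirr' hsq hK ht ht' g hg hleast
  obtain ⟨x₁, x₃, hx₁, hx₃⟩ := hex W
  have hmem : evalReal g x₃ ∈ realTwoTorsionRoots W' := evalReal_mem_realTwoTorsionRoots_of_carries hg hx₃.1
  have hle : evalReal g x₁ ≤ evalReal g x₃ := (hleast x₁ hx₁).2 _ hmem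
  exact ((h W W' f f' hN hW hW' hf hf' hirr hirr' hsq hK ht ht' g hg x₁ x₃ hx₁ hx₃).1) hle

/-- C183b (GLUE, sorry-free): **P53s♭ ⟹ P53s≤ (flat half)** pointwise, granted least/greatest roots exist
(re-derivation of -imc's bookkeeping `dvd_two_mul_of_eq_or_double` at the level of the two laws). -/
theorem flatBound_of_flatLaw (h : TwoSelmerRankTransferLawFlatAtTwo)
    (hex : ∀ W : WeierstrassCurve ℚ, ∃ x₁ x₃ : ℝ, IsLeastTwoTorsionRoot W x₁ ∧ IsGreatestTwoTorsionRoot W x₃)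
    {N : ℕ} [NeZero N] (W W' : WeierstrassCurve ℚ) (f f' : CuspForm (Gamma0 N) 2)
    (hN : Odd N) (hW : W.IsElliptic) (hW' : W'.IsElliptic) (hf : IsNewformOf W f) (hf' : IsNewformOf W' f')
    (hirr : Irreducible W.twoTorsionPolynomial.toPoly) (hirr' : Irreducible W'.twoTorsionPolynomial.toPoly)
    (hsq : ¬ IsSquare W.Δ) (ht : Odd W.tamagawaProduct) (ht' : Odd W'.tamagawaProduct)
    (g : Polynomial ℚ) (hg : CarriesTwoTorsion W W' g) (hflat : MapsConnectedTwoTorsionRootAtTwo W W' g) :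
    selmerTwoCard W ∣ 2 * selmerTwoCard W' ∧ selmerTwoCard W' ∣ 2 * selmerTwoCard W := by
  obtain ⟨x₁, x₃, hx₁, hx₃⟩ := hex W
  have hab := h W W' f f' hN hW hW' hf hf' hirr hirr' hsq ht ht' g hg hflat x₁ x₃ hx₁ hx₃
  rcases le_or_gt (evalReal g x₁) (evalReal g x₃) with hle | hlt
  · exact dvd_two_mul_of_eq_or_double (Or.inl (hab.1 hle))
  · exact dvd_two_mul_of_eq_or_double (Or.inr (hab.2 hlt))

/-- T183g (kernel of the «double isotropy» step, decidable): on `V = 𝔽₂²` the Weil pairing of two DISTINCT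
non-zero vectors is `1`; hence for ANY quadratic refinement `q` (polar form = Weil pairing) two distinct
non-zero isotropic vectors have an ANISOTROPIC sum — the isotropic vectors of `q_∞` never contain a plane, so
the image `I` of the `∞`-relaxed Selmer group (isotropic for `q_∞(E)` and for `q_∞(E')`) has order `≤ 2`. -/
theorem weilPairing_ne_distinct (v w : ZMod 2 × ZMod 2) (hv : v ≠ 0) (hw : w ≠ 0) (hvw : v ≠ w) :
    v.1 * w.2 + v.2 * w.1 = 1 := by
  revert v w; decide

/-- T183g′: the polar-form version — `q (v + w) = 1` for distinct non-zero `q`-isotropic `v, w`. -/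
theorem anisotropic_sum_of_isotropic (q : ZMod 2 × ZMod 2 → ZMod 2)
    (hpol : ∀ v w, q (v + w) = q v + q w + (v.1 * w.2 + v.2 * w.1))
    (v w : ZMod 2 × ZMod 2) (hv : v ≠ 0) (hw : w ≠ 0) (hvw : v ≠ w) (hqv : q v = 0) (hqw : q w = 0) :
    q (v + w) = 1 := by
  rw [hpol, hqv, hqw, weilPairing_ne_distinct v w hv hw hvw]; ring

/-- T183h (REF1's answer to D-imc-53-R5 (iv) / REF2 v49 §2 «q_∞ zero set = outer roots: a finite
computation», recorded as the finite table it reduces to).  With `e₁ < e₂ < e₃`, `H¹(ℝ, E[2]) =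
{(s₁,s₂,s₃) ∈ {±1}³ : s₁s₂s₃ = +1}` (class of `T_i = (e_i,0)` has `s_j = −1` iff `j ≠ i`), and the
Poonen–Rains form is the class of the conic `(e₃−e₂)s₁X² − (e₃−e₁)s₂Y² + (e₂−e₁)s₃Z² = 0` (the cone of the
pencil through the `2`-covering `x − e_i = s_i u_i²` whose fibres are `{P, −P}`, i.e. the twist of
`𝒪(2·O)`), which is split over `ℝ` iff the signs `(s₁, −s₂, s₃)` are not all equal.  Table: `0 ↦ split`,
`T₁ = (+,−,−) ↦ split`, `T₃ = (−,−,+) ↦ split`, `T₂ = (−,+,−) ↦ NON-split`: the anisotropic vector is the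
MIDDLE root class, the isotropic lines are `⟨T₁⟩` (Kummer line of `E`) and `⟨T₃⟩` (Kummer line of `E⁽⁻¹⁾`). -/
def prConicSplitsOverR (s₁ s₂ s₃ : Bool) : Bool :=   -- `true` = +1; split iff (s₁, ¬s₂, s₃) not all equal
  !((s₁ == !s₂) && (!s₂ == s₃))

/-- T183h, the table itself (REF1 §183 (iv)): `0 ↦ split`, `T₁ ↦ split`, `T₂ ↦ NON-split`, `T₃ ↦ split` — the zero set of the archimedean
Poonen–Rains form is `{0, T₁, T₃}` (docstring added by the typer; statement and proof REF1's verbatim). -/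
theorem prForm_zero_set_eq_outer_roots :
    (prConicSplitsOverR true true true = true) ∧      -- 0
    (prConicSplitsOverR true false false = true) ∧    -- T₁ (least): isotropic
    (prConicSplitsOverR false true false = false) ∧   -- T₂ (middle): ANISOTROPIC
    (prConicSplitsOverR false false true = true) := by decide   -- T₃ (greatest): isotropic

end Certificates183

/-! ## Typer discharge of REF1 R183f (`hex`) and the unconditional corollaries C183a′/C183b′ -/

/-- R183f, step 1: the real `2`-division cubic `ψ_W` (leading coefficient `4`, degree `3`) has a real root — every `W`, no
discriminant hypothesis needed (odd degree over `ℝ`; the tree's `exists_isRoot_of_odd_natDegree`). -/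
theorem exists_mem_realTwoTorsionRoots (W : WeierstrassCurve ℚ) : ∃ x : ℝ, x ∈ realTwoTorsionRoots W := by
  have ha : W.twoTorsionPolynomial.a ≠ 0 := by norm_num [WeierstrassCurve.twoTorsionPolynomial]
  have hne : (W.twoTorsionPolynomial.toPoly).map (algebraMap ℚ ℝ) ≠ 0 := by
    rw [Ne, Polynomial.map_eq_zero_iff (algebraMap ℚ ℝ).injective]
    exact Cubic.ne_zero_of_a_ne_zero ha
  have hdeg : ((W.twoTorsionPolynomial.toPoly).map (algebraMap ℚ ℝ)).natDegree = 3 := by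
    rw [Polynomial.natDegree_map_eq_of_injective (algebraMap ℚ ℝ).injective]
    exact Cubic.natDegree_of_a_ne_zero ha
  obtain ⟨x, hx⟩ :=
    Literature.LinearAlgebra.Matrix.CharpolyShiftOddOrderRankOnePencil.exists_isRoot_of_odd_natDegree
      (p := (W.twoTorsionPolynomial.toPoly).map (algebraMap ℚ ℝ)) (by rw [hdeg]; exact ⟨1, by norm_num⟩)
  exact ⟨x, (Polynomial.mem_roots hne).mpr hx⟩

/-- **R183f discharged**: every `ψ_W` has a least and a greatest real root (the finite non-empty set of real roots has a `min'`
and a `max'`).  This is the hypothesis `hex` of REF1's glue C183a/C183b, so both corollaries below are unconditional. -/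
theorem exists_isLeast_isGreatest (W : WeierstrassCurve ℚ) :
    ∃ x₁ x₃ : ℝ, IsLeastTwoTorsionRoot W x₁ ∧ IsGreatestTwoTorsionRoot W x₃ := by
  classical
  obtain ⟨x, hx⟩ := exists_mem_realTwoTorsionRoots W
  have hne : (realTwoTorsionRoots W).toFinset.Nonempty := ⟨x, Multiset.mem_toFinset.mpr hx⟩
  refine ⟨(realTwoTorsionRoots W).toFinset.min' hne, (realTwoTorsionRoots W).toFinset.max' hne,
    ⟨Multiset.mem_toFinset.mp (Finset.min'_mem _ hne), fun y hy => Finset.min'_le _ y (Multiset.mem_toFinset.mpr hy)⟩,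
    ⟨Multiset.mem_toFinset.mp (Finset.max'_mem _ hne), fun y hy => Finset.le_max' _ y (Multiset.mem_toFinset.mpr hy)⟩⟩

/-- **C183a′ (unconditional glue): P53s ⟹ P53s₀** — REF1's `companionLaw_of_transferLaw` with `hex` discharged. -/
theorem companionLaw_of_transferLaw' (h : TwoSelmerRankTransferLawAtTwo) : TwoSelmerCompanionLawAtTwo :=
  companionLaw_of_transferLaw h exists_isLeast_isGreatest

/-- **C183b′ (unconditional glue): P53s♭ ⟹ the flat conjunct of P53s≤** pointwise — REF1's `flatBound_of_flatLaw` with `hex`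
discharged (the `∣ 4·` conjunct of `TwoSelmerTransferBoundAtTwo` is a separate theorem-candidate, REF1 §183 window argument). -/
theorem flatBound_of_flatLaw' (h : TwoSelmerRankTransferLawFlatAtTwo)
    {N : ℕ} [NeZero N] (W W' : WeierstrassCurve ℚ) (f f' : CuspForm (Gamma0 N) 2)
    (hN : Odd N) (hW : W.IsElliptic) (hW' : W'.IsElliptic) (hf : IsNewformOf W f) (hf' : IsNewformOf W' f')
    (hirr : Irreducible W.twoTorsionPolynomial.toPoly) (hirr' : Irreducible W'.twoTorsionPolynomial.toPoly)
    (hsq : ¬ IsSquare W.Δ) (ht : Odd W.tamagawaProduct) (ht' : Odd W'.tamagawaProduct)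
    (g : Polynomial ℚ) (hg : CarriesTwoTorsion W W' g) (hflat : MapsConnectedTwoTorsionRootAtTwo W W' g) :
    selmerTwoCard W ∣ 2 * selmerTwoCard W' ∧ selmerTwoCard W' ∣ 2 * selmerTwoCard W :=
  flatBound_of_flatLaw h exists_isLeast_isGreatest W W' f f' hN hW hW' hf hf' hirr hirr' hsq ht ht' g hg hflat

/-- The two halves filed as ONE implication between the typed rows: P53s♭ ⟹ P53s≤'s flat conjunct for every framed pair
(REF1 §183: «P53s₀ and P53s≤(flat) should be COROLLARY rows of P53s/P53s♭, not separate obligations»). -/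
theorem transferBound_flat_of_flatLaw (h : TwoSelmerRankTransferLawFlatAtTwo) :
    ∀ {N : ℕ} [NeZero N] (W W' : WeierstrassCurve ℚ) (f f' : CuspForm (Gamma0 N) 2),
      Odd N → W.IsElliptic → W'.IsElliptic → IsNewformOf W f → IsNewformOf W' f' →
      Irreducible W.twoTorsionPolynomial.toPoly → Irreducible W'.twoTorsionPolynomial.toPoly →
      ¬ IsSquare W.Δ → Odd W.tamagawaProduct → Odd W'.tamagawaProduct →
      ∀ g : Polynomial ℚ, CarriesTwoTorsion W W' g → MapsConnectedTwoTorsionRootAtTwo W W' g →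
        selmerTwoCard W ∣ 2 * selmerTwoCard W' ∧ selmerTwoCard W' ∣ 2 * selmerTwoCard W :=
  fun W W' f f' hN hW hW' hf hf' hirr hirr' hsq ht ht' g hg hflat =>
    flatBound_of_flatLaw' h W W' f f' hN hW hW' hf hf' hirr hirr' hsq ht ht' g hg hflat

end Summit.BirchSwinnertonDyer.Rank1Residual.F1Sign2

end
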